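import Summits.HodgeConjecture.HodgeConjecture.Theorems.VHCAbelianSchemesRoadWeilLineAnchorsOver
import Summits.HodgeConjecture.HodgeConjecture.Theorems.VHCAbelianSchemesRoadWeilLineKodairaGlueOver
import Summits.HodgeConjecture.HodgeConjecture.Theorems.Ring2AbelianAllCMAlgebraicCarriersDefs
import Summits.HodgeConjecture.HodgeConjecture.Theorems.Ring2DeformCompactPencils
import Summits.HodgeConjecture.HodgeConjecture.Theses.VHCAbelianSchemesRoad
import HarnessLib

/-!
# Ring 2 / AbelianAll (André column) — split Weil classes, `HC_CM` and `HC_AV` (with `HC_CM` idle) FROM ONE CARRIED `E`-WEIL CLASS PER TENSOR STRUCTURE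
# OVER ANCHOR VARIETIES OF OUR CHOICE (`dim Y_p ∣ p`, `dim Y_p ≤ 3`) — the rows of PART AE-II on the cell's named decls (leaf file)

research route, not a corollary; conditional on HC_CM plus one named minimal statement.

LEAF FILE (imports the route file; nothing should import it). PART AE-II: André's proof of Lemme 6.3.3 builds its pencil from an ARBITRARY polarised weight-one
`ℚ`-Hodge structure of rank `2p` («par exemple» an elliptic power) — Literature `andre1996_splitWeilClasses_weilLinePencil_over` /
`andre1996_cmHodgeClasses_weilLinePencils_over` (statement only; the special fibre prescribed isogenous to a power of ANY `Y₀` with `0 < dim Y₀ ∣ p`, the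
algebraicity of Hodge classes on such varieties as a hypothesis on `Y₀`, a THEOREM of the tree for `dim Y₀ ≤ 3`). So the elliptic curve `E₀` of gen 61's rows
may be replaced, codimension by codimension, by an anchor variety `Y_p` OF OUR CHOICE with `dim Y_p ∣ p`, `dim Y_p ≤ 3`:

* §1 **split `E`-Weil classes in codimension `p`** ⟸ K-C ∧ `TwistedPerfectDoor` ∧ the prescribed-fibre split fact ∧ `OneTensorWeilHodgeClassTwistedCarriersAt Y₀ (dim B) p`
  for ONE `Y₀` with `0 < dim Y₀ ≤ 3`, `dim Y₀ ∣ p`; the two argument-free instances `SexticTensorSixfoldOneTwistedCarrierOverThreefold` (cell `(6,3)`, imaginary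
  quadratic `K`; over a generic genus-3 Jacobian the anchor is Markman's `J(C) ⊗ 𝒪_K`, where semiregular twisted secant sheaves EXIST IN PRINT) and
  `QuarticTensorEightfoldOneTwistedCarrierOverSurface` (cell `(8,2)`, quartic CM fields; Markman's postponed real-multiplication case) with their rows;
* §2 **`HC_CM ⟸ K-C ∧ TwistedPerfectDoor ∧ andre1996_cmHodgeClasses_weilLinePencils_over ∧ (anchors Y : ℕ → AbelianVariety ℂ, 0 < dim (Y p) ∣ p, dim (Y p) ≤ 3) ∧
  (∀ n p, 2 ≤ p ≤ n − 2 → OneTensorWeilHodgeClassTwistedCarriersAt (Y p) n p)`**;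
* §3 **`HC_AV ⟸ K-C ∧ TwistedPerfectDoor ∧ AndreCMAnchoredPencil ∧ andre1996_cmHodgeClasses_weilLinePencils_over ∧ CMAlgebraicTwistedCarriers ∧ (anchors as in §2) ∧
  (per-cell guarded twisted nodes over them)`** — THE ANDRÉ COLUMN'S `B_min` OF GEN 62 (`HC_CM` IDLE): gen 61's `B_min` with «powers of ONE elliptic curve» weakened
  to «powers of one anchor variety of our choice per codimension, of dimension dividing `p` and at most `3`»;
* §4 recovery: the constant family `Y p := E₀` (`dim E₀ = 1`) gives back gen 61's rows granted the prescribed-fibre facts.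

HONEST: every carrier node is OPEN, NOT implied by the Hodge conjecture; PART AE (evidence on the crux item) proves that NO direct sum of line bundles ∕
semi-homogeneous bundles ∕ structure sheaves of abelian subvarieties, and no ideal sheaf of a generic union of translated abelian subvarieties, is such a carrier
at a Weil-type point: the object must be indecomposable with Chern character in the generic Hodge ring of the Weil family (Markman's secant sheaves are); at the
`(6,3)` anchors over a generic genus-3 Jacobian such objects exist in print (arXiv:2502.03415, every `d`; twisted sheaf on a quotient by a finite group, sides in
the `E′⁺θ`-algebra — the door's format must accommodate both), nowhere else. The prescribed-fibre facts are faithful to André's PROOF (p. 33), weaker than print,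
and enter BY NAME; Lemme 6.3.1 and the door are the road's binders. Nothing here says any carrier, door, Weil class, `HC_CM`, `HC_AV` or HC holds.
References: [cite: Andre1996Motifs, §6.3 a)–c), Lemmes 6.3.1–6.3.3 and proof of 6.3.3 (pp. 31–33)] [cite: MoonenZarhin1999LowDim, Thm. 0.1 (4)]
[cite: MoonenZarhin1998WeilClasses, §1] [cite: Markman2025SecantWeil, §1 Thm. 1 and §7.3] [cite: Markman2025SecantRealMultiplication, §1.1]
[cite: Bloch1972Semiregularity, Remark (7.5)] [cite: BuchweitzFlenner2003, Prop. 4.2, Prop. 4.4 and §5 Thm. 5.1] [cite: Pridham2024Semiregularity, Cor. 2.25 and Rem. 2.26–2.27]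
[cite: Milne1999, §7 p. 72].
-/

noncomputable section

open CategoryTheory CategoryTheory.Limits AlgebraicGeometry Topology

namespace Summit.HodgeConjecture.HodgeConjecture.Ring2.AbelianAll

-- the cell's namespace repeats the summit name (`Summit.HodgeConjecture.HodgeConjecture…`), as in every `Ring2*` file
set_option linter.dupNamespace false

open Literature.AlgebraicGeometry Literature.AlgebraicGeometry.Motives
open Literature.AlgebraicGeometry.HodgeTheory
open Literature.AlgebraicGeometry.Deligne1982
open Literature.AlgebraicGeometry.VanGeemen1994 (pullbackOne)
open Literature.AlgebraicTopology.SingularHomology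
open Literature.AlgebraicGeometry.Milne1999 (IsOfCMType CMHodgeHypothesisAt)
open Literature.AlgebraicGeometry.Andre1996 (andre1996_cmAnchoredPencil andre1996_splitWeilClasses_weilLinePencil_over andre1996_cmHodgeClasses_weilLinePencils_over)
open Summit.Ventures.HSemireg (ObjClass LocalVariationalHodgeFor)
open Summit.HodgeConjecture.HodgeConjecture.Theses
open Summit.HodgeConjecture.HodgeConjecture.Ring2.SemiregularRepresentatives (AnchoredCarrierAt twistedPerfectDoorVHC_iff_localVariationalHodgeFor
  weilClassesField_le_algebraicClasses_of_split_of_weilLinePencilOver_of_door_of_oneTensorWeilHodgeClassCarriersAt_of_dim_le_three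
  cmHodgeHypothesisAt_of_weilLinePencilsOver_of_door_of_family_of_dim_le_three
  forall_hodgeConjectureFor_of_andre1996_of_weilLinePencilsOver_of_door_of_cmAlgebraic_of_family hodgeConjectureFor_of_isIsogenous_powSucc_of_dim_le_three
  oneTensorWeilHodgeClassCarriersAt_of_oneTensorWeilHodgeClassCarriers)

variable {p : ℕ} {B : AbelianVariety ℂ} {η : B ⟶ B} {R : Polynomial ℤ} {e₀ : ℕ}
  {e : ProjectiveEmbedding B.X} {a : complexBetti (projectiveSpace e.n ℂ) 2}

/-! ## §1 Split `E`-Weil classes in codimension `p` over ONE anchor variety of our choice -/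

/-- **`W_E(B) ⊗ ℂ` algebraic ⟸ K-C ∧ TwistedPerfectDoor ∧ andre1996_splitWeilClasses_weilLinePencil_over ∧ (ONE `Y₀` with `0 < dim Y₀ ≤ 3`, `dim Y₀ ∣ p`) ∧
OneTensorWeilHodgeClassTwistedCarriersAt Y₀ (dim B) p**, for every split `E`-Weil datum `(B, η, R, e₀, p, e, a)` (`IsWeilTypeCM`, `E`-compatible hyperplane class,
`IsHyperbolicWeilType`): the Weil classes of every split structure in codimension `p`, every CM field, from ONE twisted carrier per tensor structure on the abelian
`dim B`-folds isogenous to powers of `Y₀` — the anchor variety's Hodge classes being algebraic in the tree (Moonen–Zarhin). NO CM hypothesis on `B`; `HC_CM` absent.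
[cite: Andre1996Motifs, proof of Lemme 6.3.3 (p. 33) with §6.3 a)–b)] [cite: MoonenZarhin1999LowDim, Thm. 0.1 (4)] [cite: Pridham2024Semiregularity, Cor. 2.25 and Rem. 2.26–2.27] -/
theorem weilClassesField_le_algebraicClasses_of_split_of_oneTensorWeilHodgeClassTwistedCarriersAt (hC : VHCAbelianSchemesRoad.ChernCharacterOnBetti)
    (hDoor : VHCAbelianSchemesRoad.TwistedPerfectDoor) (h633 : andre1996_splitWeilClasses_weilLinePencil_over) {Y₀ : AbelianVariety ℂ} (hY₀ : 0 < Y₀.dim)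
    (h3 : Y₀.dim ≤ 3) (hdvd : Y₀.dim ∣ p) (hone : OneTensorWeilHodgeClassTwistedCarriersAt Y₀ B.dim p) (hB : IsWeilTypeCM B η R e₀ p) (ha : IsRationalClass a)
    (ha₀ : a ≠ 0)
    (hRos : ∀ x y : complexBetti B.X 1,
      polarizationPairingOne B.X (complexBetti.map e.ι 2 a) (B.dim - 1) (pullbackOne B η x) y =
        -polarizationPairingOne B.X (complexBetti.map e.ι 2 a) (B.dim - 1) x (pullbackOne B η y))
    (hsplit : IsHyperbolicWeilType B η (p * e₀) (complexBetti.map e.ι 2 a)) :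
    weilClassesField B η (R.comp (Polynomial.X ^ 2)) (2 * p) ≤ algebraicClasses B.X p := by
  obtain ⟨C⟩ := (hC : Nonempty ChernCharacterBetti)
  exact weilClassesField_le_algebraicClasses_of_split_of_weilLinePencilOver_of_door_of_oneTensorWeilHodgeClassCarriersAt_of_dim_le_three h633
    ((twistedPerfectDoorVHC_iff_localVariationalHodgeFor C _).1 (hDoor C)) hY₀ h3 hdvd (hone C) hB ha ha₀ hRos hsplit

/-- **THE `(6,3)` INSTANCE: the codimension-3 Weil classes of every split Weil SIXFOLD with imaginary-quadratic multiplication ⟸ K-C ∧ TwistedPerfectDoor ∧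
andre1996_splitWeilClasses_weilLinePencil_over ∧ SexticTensorSixfoldOneTwistedCarrierOverThreefold** (ONE twisted carrier per imaginary-quadratic structure on the
sixfolds isogenous to a power of SOME abelian threefold — over a generic genus-3 Jacobian these are Markman's anchors, where such sheaves exist in print).
[cite: Markman2025SecantWeil, §1 Thm. 1] [cite: Andre1996Motifs, proof of Lemme 6.3.3 (p. 33)] [cite: MoonenZarhin1999LowDim, Thm. 0.1 (4)] -/
theorem weilClassesField_le_algebraicClasses_splitSixfold_of_sexticTensorSixfoldOneTwistedCarrierOverThreefold
    (hC : VHCAbelianSchemesRoad.ChernCharacterOnBetti) (hDoor : VHCAbelianSchemesRoad.TwistedPerfectDoor) (h633 : andre1996_splitWeilClasses_weilLinePencil_over)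
    (hS : SexticTensorSixfoldOneTwistedCarrierOverThreefold) (hB : IsWeilTypeCM B η R 1 3) (ha : IsRationalClass a) (ha₀ : a ≠ 0)
    (hRos : ∀ x y : complexBetti B.X 1,
      polarizationPairingOne B.X (complexBetti.map e.ι 2 a) (B.dim - 1) (pullbackOne B η x) y =
        -polarizationPairingOne B.X (complexBetti.map e.ι 2 a) (B.dim - 1) x (pullbackOne B η y))
    (hsplit : IsHyperbolicWeilType B η (3 * 1) (complexBetti.map e.ι 2 a)) :
    weilClassesField B η (R.comp (Polynomial.X ^ 2)) (2 * 3) ≤ algebraicClasses B.X 3 := by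
  obtain ⟨Y₀, hY₀, hcell⟩ := hS
  have hdim : B.dim = 6 := by rw [hB.dim_eq]
  refine weilClassesField_le_algebraicClasses_of_split_of_oneTensorWeilHodgeClassTwistedCarriersAt hC hDoor h633 (Y₀ := Y₀) (by omega) (by omega)
    (by rw [hY₀]) ?_ hB ha ha₀ hRos hsplit
  rw [hdim]
  exact hcell

/-- **THE `(8,2)` INSTANCE OVER A SURFACE: the codimension-2 Weil classes of every split Weil EIGHTFOLD with multiplication by a QUARTIC CM field ⟸ K-C ∧ TwistedPerfectDoor
∧ andre1996_splitWeilClasses_weilLinePencil_over ∧ QuarticTensorEightfoldOneTwistedCarrierOverSurface** (ONE twisted carrier per quartic structure on the eightfolds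
isogenous to a power of SOME abelian surface — the K3-partner habitat; Markman's postponed real-multiplication case).
[cite: Markman2025SecantRealMultiplication, §1.1] [cite: Andre2026, §4.4.4] [cite: Andre1996Motifs, proof of Lemme 6.3.3 (p. 33)] [cite: MoonenZarhin1999LowDim, Thm. 0.1 (4)] -/
theorem weilClassesField_le_algebraicClasses_quarticSplitEightfold_of_quarticTensorEightfoldOneTwistedCarrierOverSurface
    (hC : VHCAbelianSchemesRoad.ChernCharacterOnBetti) (hDoor : VHCAbelianSchemesRoad.TwistedPerfectDoor) (h633 : andre1996_splitWeilClasses_weilLinePencil_over)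
    (hQ : QuarticTensorEightfoldOneTwistedCarrierOverSurface) (hB : IsWeilTypeCM B η R 2 2) (ha : IsRationalClass a) (ha₀ : a ≠ 0)
    (hRos : ∀ x y : complexBetti B.X 1,
      polarizationPairingOne B.X (complexBetti.map e.ι 2 a) (B.dim - 1) (pullbackOne B η x) y =
        -polarizationPairingOne B.X (complexBetti.map e.ι 2 a) (B.dim - 1) x (pullbackOne B η y))
    (hsplit : IsHyperbolicWeilType B η (2 * 2) (complexBetti.map e.ι 2 a)) :
    weilClassesField B η (R.comp (Polynomial.X ^ 2)) (2 * 2) ≤ algebraicClasses B.X 2 := by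
  obtain ⟨Y₀, hY₀, hcell⟩ := hQ
  have hdim : B.dim = 8 := by rw [hB.dim_eq]
  refine weilClassesField_le_algebraicClasses_of_split_of_oneTensorWeilHodgeClassTwistedCarriersAt hC hDoor h633 (Y₀ := Y₀) (by omega) (by omega)
    (by rw [hY₀]) ?_ hB ha ha₀ hRos hsplit
  rw [hdim]
  exact hcell

/-! ## §2 `HC_CM` from one carried class per tensor structure over a family of anchor varieties of our choice -/

/-- **`HC_CM ⟸ K-C ∧ TwistedPerfectDoor ∧ andre1996_cmHodgeClasses_weilLinePencils_over ∧ (anchors `Y p`, `0 < dim (Y p) ∣ p`, `dim (Y p) ≤ 3`) ∧ the guarded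
twisted node over `Y p` at every cell `(n, p)` with `2 ≤ p ≤ n − 2`**: the Hodge conjecture for CM abelian varieties from ONE semiregular twisted representative,
modulo the `θ`-ray, of ONE non-zero rational `E`-Weil class per CM-field structure (with a Hodge witness) and polarisation on the abelian varieties isogenous to
powers of ANCHOR VARIETIES OF OUR CHOICE, one per codimension. [cite: Andre1996Motifs, §6.3 Lemmes 6.3.2–6.3.3 and proof (pp. 32–33)]
[cite: MoonenZarhin1999LowDim, Thm. 0.1 (4)] [cite: Pridham2024Semiregularity, Cor. 2.25 and Rem. 2.26–2.27] [cite: Milne1999, §7 p. 72] -/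
theorem HC_CM_of_oneTensorWeilHodgeClassTwistedCarriersAt_family (hC : VHCAbelianSchemesRoad.ChernCharacterOnBetti)
    (hDoor : VHCAbelianSchemesRoad.TwistedPerfectDoor) (h₂₂ : andre1996_cmHodgeClasses_weilLinePencils_over) (Y : ℕ → AbelianVariety ℂ)
    (hY : ∀ p, 0 < (Y p).dim ∧ (Y p).dim ∣ p ∧ (Y p).dim ≤ 3)
    (hone : ∀ n p : ℕ, 2 ≤ p → p + 2 ≤ n → OneTensorWeilHodgeClassTwistedCarriersAt (Y p) n p) : RankFourFaces.CMAbelianHodge := by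
  obtain ⟨C⟩ := (hC : Nonempty ChernCharacterBetti)
  exact fun B hB' hcm ↦ cmHodgeHypothesisAt_of_weilLinePencilsOver_of_door_of_family_of_dim_le_three h₂₂
    ((twistedPerfectDoorVHC_iff_localVariationalHodgeFor C _).1 (hDoor C)) Y hY (fun n p hp hn ↦ hone n p hp hn C) B hB' hcm

/-! ## §3 `HC_AV` with `HC_CM` idle — the André column's `B_min` of gen 62 -/

/-- **`HC_AV ⟸ K-C ∧ TwistedPerfectDoor ∧ AndreCMAnchoredPencil ∧ andre1996_cmHodgeClasses_weilLinePencils_over ∧ CMAlgebraicTwistedCarriers ∧ (anchors `Y p` of our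
choice, `0 < dim (Y p) ∣ p`, `dim (Y p) ≤ 3`) ∧ (the guarded twisted node over `Y p` at every cell)`** — THE ANDRÉ COLUMN'S `B_min` OF GEN 62 (`HC_CM` IDLE):
semiregular twisted representatives, modulo the `θ`-ray, of KNOWN ALGEBRAIC classes (i) of codimension `2 ≤ p`, `2p + 4 ≤ n` on polarised CM abelian `n`-folds and
(ii) of ONE non-zero rational `E`-Weil class per CM-field structure (exhibiting a Hodge witness) and polarisation, codimension `2 ≤ p ≤ n − 2`, on the polarised abelian
`n`-folds isogenous to powers of `Y p` — an anchor variety OF OUR CHOICE per codimension (an elliptic curve, an abelian surface when `2 ∣ p`, an abelian threefold when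
`3 ∣ p`). [cite: Andre1996Motifs, §6.3 (pp. 31–33)] [cite: MoonenZarhin1999LowDim, Thm. 0.1 (4)] [cite: Pridham2024Semiregularity, Cor. 2.25 and Rem. 2.26–2.27]
[cite: Bloch1972Semiregularity, Remark (7.5)] -/
theorem HC_AV_of_cmAlgebraic_and_oneTensorWeilHodgeClass_twistedCarriersAt_family (hC : VHCAbelianSchemesRoad.ChernCharacterOnBetti)
    (hDoor : VHCAbelianSchemesRoad.TwistedPerfectDoor) (h₂₁ : VHCAbelianSchemesRoad.AndreCMAnchoredPencil) (h₂₂ : andre1996_cmHodgeClasses_weilLinePencils_over)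
    (hcm : CMAlgebraicTwistedCarriers) (Y : ℕ → AbelianVariety ℂ) (hY : ∀ p, 0 < (Y p).dim ∧ (Y p).dim ∣ p ∧ (Y p).dim ≤ 3)
    (hone : ∀ n p : ℕ, 2 ≤ p → p + 2 ≤ n → OneTensorWeilHodgeClassTwistedCarriersAt (Y p) n p) : PadicSemiregularLift.HodgeAbelianVarieties := by
  obtain ⟨C⟩ := (hC : Nonempty ChernCharacterBetti)
  exact fun A ↦ forall_hodgeConjectureFor_of_andre1996_of_weilLinePencilsOver_of_door_of_cmAlgebraic_of_family h₂₁ h₂₂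
    ((twistedPerfectDoorVHC_iff_localVariationalHodgeFor C _).1 (hDoor C)) (fun n p h2 h4 ↦ hcm C n p h2 h4) Y (fun p ↦ ⟨(hY p).1, (hY p).2.1⟩)
    (fun p ↦ hodgeConjectureFor_of_isIsogenous_powSucc_of_dim_le_three (hY p).1 (hY p).2.2) (fun n p hp hn ↦ hone n p hp hn C) A

/-! ## §4 Recovery of gen 61's rows: the constant family at one elliptic curve -/

/-- **`HC_AV ⟸ K-C ∧ TwistedPerfectDoor ∧ AndreCMAnchoredPencil ∧ andre1996_cmHodgeClasses_weilLinePencils_over ∧ CMAlgebraicTwistedCarriers ∧ (ONE elliptic curve E₀) ∧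
OneTensorWeilHodgeClassTwistedCarriers E₀`** — gen 61's `B_min` row, now from the prescribed-fibre fact via the constant family `Y p := E₀`.
[cite: Andre1996Motifs, §6.3 (pp. 31–33)] [cite: MoonenZarhin1999LowDim, Thm. 0.1 (4)] -/
theorem HC_AV_of_cmAlgebraic_and_oneTensorWeilHodgeClass_twistedCarriers_of_over (hC : VHCAbelianSchemesRoad.ChernCharacterOnBetti)
    (hDoor : VHCAbelianSchemesRoad.TwistedPerfectDoor) (h₂₁ : VHCAbelianSchemesRoad.AndreCMAnchoredPencil) (h₂₂ : andre1996_cmHodgeClasses_weilLinePencils_over)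
    (hcm : CMAlgebraicTwistedCarriers) {E₀ : AbelianVariety ℂ} (hE₀ : E₀.dim = 1) (hone : OneTensorWeilHodgeClassTwistedCarriers E₀) :
    PadicSemiregularLift.HodgeAbelianVarieties :=
  HC_AV_of_cmAlgebraic_and_oneTensorWeilHodgeClass_twistedCarriersAt_family hC hDoor h₂₁ h₂₂ hcm (fun _ ↦ E₀)
    (fun p ↦ ⟨by omega, by rw [hE₀]; exact one_dvd p, by omega⟩)
    (fun _ _ hp hn C ↦ oneTensorWeilHodgeClassCarriersAt_of_oneTensorWeilHodgeClassCarriers (hone C) hp hn)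

/-! ## §5 (appended) WITH KODAIRA: ONE ANDRÉ FACT (Lemme 6.3.3 alone, prescribed-fibre line form) for `HC_CM` and `B_min` over anchors of our choice -/

section KodairaOver

open Summit.HodgeConjecture.HodgeConjecture.Ring2.SemiregularRepresentatives
  (cmHodgeHypothesisAt_of_kodaira_of_splitWeilLinePencilOver_of_door_of_family_of_dim_le_three
   forall_hodgeConjectureFor_of_kodaira_of_andre1996_of_splitWeilLinePencilOver_of_door_of_cmAlgebraic_of_family)

/-- **`HC_CM ⟸ K-C ∧ TwistedPerfectDoor ∧ Kodaira ∧ andre1996_splitWeilClasses_weilLinePencil_over ∧ (anchors Y p of our choice, 0 < dim ∣ p, ≤ 3) ∧ per-cell twisted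
one-class nodes over them`** — Lemme 6.3.2 (André 1992) is a theorem of the tree (CorCM), so the Hodge conjecture for CM abelian varieties needs ONE André fact (6.3.3
alone, prescribed-fibre line form), Kodaira's embedding theorem, the door, and ONE carried non-zero rational `E`-Weil class per tensor structure over the chosen anchors.
[cite: Andre1996Motifs, §6.3 (pp. 32–33)] [cite: Andre1992HodgeCM, Théorème] [cite: Huybrechts2005, Prop. 5.3.1, Cor. 5.3.3] [cite: MoonenZarhin1999LowDim, Thm. 0.1 (4)]
[cite: Pridham2024Semiregularity, Cor. 2.25 and Rem. 2.26–2.27] -/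
theorem HC_CM_of_kodaira_of_splitWeilLinePencilOver_of_oneTensorWeilHodgeClassTwistedCarriersAt_family (hC : VHCAbelianSchemesRoad.ChernCharacterOnBetti)
    (hDoor : VHCAbelianSchemesRoad.TwistedPerfectDoor) (hK : Kodaira1954_rationalKaehlerClass_eq_hyperplaneClass)
    (h633 : andre1996_splitWeilClasses_weilLinePencil_over) (Y : ℕ → AbelianVariety ℂ) (hY : ∀ p, 0 < (Y p).dim ∧ (Y p).dim ∣ p ∧ (Y p).dim ≤ 3)
    (hone : ∀ n p : ℕ, 2 ≤ p → p + 2 ≤ n → OneTensorWeilHodgeClassTwistedCarriersAt (Y p) n p) : RankFourFaces.CMAbelianHodge := by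
  obtain ⟨C⟩ := (hC : Nonempty ChernCharacterBetti)
  exact fun B hB' hcm ↦ cmHodgeHypothesisAt_of_kodaira_of_splitWeilLinePencilOver_of_door_of_family_of_dim_le_three hK h633
    ((twistedPerfectDoorVHC_iff_localVariationalHodgeFor C _).1 (hDoor C)) Y hY (fun n p hp hn ↦ hone n p hp hn C) B hB' hcm

/-- **`B_min` OF GEN 62 WITH ONE ANDRÉ FACT: `HC_AV ⟸ K-C ∧ TwistedPerfectDoor ∧ Kodaira ∧ AndreCMAnchoredPencil ∧ andre1996_splitWeilClasses_weilLinePencil_over ∧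
CMAlgebraicTwistedCarriers ∧ (anchors Y p of our choice, 0 < dim ∣ p, ≤ 3) ∧ per-cell twisted one-class nodes over them`** (`HC_CM` idle): besides the road's binders
(K-C, the door, Lemme 6.3.1) and Kodaira's embedding theorem, ONE André fact — the proof of Lemme 6.3.3 with prescribed special fibre — and two carrier statements.
[cite: Andre1996Motifs, §6.3 (pp. 31–33)] [cite: Andre1992HodgeCM, Théorème] [cite: MoonenZarhin1999LowDim, Thm. 0.1 (4)] [cite: Bloch1972Semiregularity, Remark (7.5)]
[cite: Pridham2024Semiregularity, Cor. 2.25 and Rem. 2.26–2.27] -/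
theorem HC_AV_of_kodaira_of_cmAlgebraic_and_oneTensorWeilHodgeClass_twistedCarriersAt_family (hC : VHCAbelianSchemesRoad.ChernCharacterOnBetti)
    (hDoor : VHCAbelianSchemesRoad.TwistedPerfectDoor) (hK : Kodaira1954_rationalKaehlerClass_eq_hyperplaneClass) (h₂₁ : VHCAbelianSchemesRoad.AndreCMAnchoredPencil)
    (h633 : andre1996_splitWeilClasses_weilLinePencil_over) (hcm : CMAlgebraicTwistedCarriers) (Y : ℕ → AbelianVariety ℂ)
    (hY : ∀ p, 0 < (Y p).dim ∧ (Y p).dim ∣ p ∧ (Y p).dim ≤ 3) (hone : ∀ n p : ℕ, 2 ≤ p → p + 2 ≤ n → OneTensorWeilHodgeClassTwistedCarriersAt (Y p) n p) :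
    PadicSemiregularLift.HodgeAbelianVarieties := by
  obtain ⟨C⟩ := (hC : Nonempty ChernCharacterBetti)
  exact fun A ↦ forall_hodgeConjectureFor_of_kodaira_of_andre1996_of_splitWeilLinePencilOver_of_door_of_cmAlgebraic_of_family hK h₂₁ h633
    ((twistedPerfectDoorVHC_iff_localVariationalHodgeFor C _).1 (hDoor C)) (fun n p h2 h4 ↦ hcm C n p h2 h4) Y (fun p ↦ ⟨(hY p).1, (hY p).2.1⟩)
    (fun p ↦ hodgeConjectureFor_of_isIsogenous_powSucc_of_dim_le_three (hY p).1 (hY p).2.2) (fun n p hp hn ↦ hone n p hp hn C) A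

end KodairaOver

/-! ## §6 (appended) Erratum to the docstrings of §1 and of `SexticTensorSixfoldOneTwistedCarrierOverThreefold` (Defs §4): the side format at `(6,3)`

The phrases «sides in the `E′⁺θ`-algebra rather than on the `θ`-ray» / «the door's side format» in the `(6,3)` docstrings over-state the gap: for an imaginary
QUADRATIC field (`n = 2p`) the Weil classes sit in the middle degree and are primitive, so `θ^i · w = 0` for `i ≥ 1` and the generic Hodge ring of the Weil family
is `ℚθ^q` in every degree `q ≠ p` — Markman's `κ_q(ℬ)`, `q ≠ 3`, ARE on the `θ`-ray («`ch_i(𝒢)` `Spin(V)_w`-invariant for all `i`; `ch₃ = s·Ĵ_ww + t·Θ_w³`»), and the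
typed side format fits. What separates the printed object from the typed node at `(6,3)` is only: (g1) the node quantifies over every polarisation and every
structure with a witness, print supplies specific `(A, η_d, Ξ_P)`; (g2) the packaging of a `μ_{8d}`-twisted reflexive sheaf on the finite quotient `(X × X̂)/Ḡ` as a
`twistedReflexiveClass C AdmTw` datum; (g3) the semiregularity notions. The side-format relaxation is needed only for `[E′:ℚ] > 2` (e.g. the `(8,2)`-quartic cell:
`θ^{q−p}·w ≠ 0`). No statement of this file changes. [cite: Markman2025SecantWeil, §6 Conj. 6.2.8 and §7] [cite: VoisinHodgeI2002, Thm. 6.25 (Lefschetz decomposition)] -/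

/-- **Bookkeeping for the erratum**: in the quadratic branch of the node the dimension IS twice the codimension (`n = 2p`), so the Weil classes are
middle-dimensional — the case in which they are primitive and the `θ`-ray side format is automatic. [folklore] -/
theorem two_mul_sub_self_eq (p : ℕ) : 2 * p - p = p := by omega

end Summit.HodgeConjecture.HodgeConjecture.Ring2.AbelianAll

end
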